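import Literature.Analysis.FluidPDE.AdaptedBackwardKernel
import Literature.Analysis.FluidPDE.WholeSpaceIBP
import Summits.NavierStokesRegularity.NavierStokesRegularity.Theorems.AdaptedFrequencyTangentFlowTransferKernelCalculus
import HarnessLib

/-!
# `AdaptedKernelExists` (stmt-NavierStokesRegularity-2956): the COMPRESSIBLE first variation against a backward kernel

Negative / support lemmas for the crux `AdaptedFrequency.AdaptedKernelExists`, extracted from the
crux work file `Cruxes/AdaptedKernelExists/Disproof.lean` (cdisprove seat, cycle 3, §7.A). No
conclusion asserts a route item.

For an open time set `S`, a field `G` jointly `C²` on `S × E` solving the adjoint equation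
`∂ₜG + u·∇G + νΔG = 0` with drift slices `u(t, ·) ∈ C¹` — NO divergence condition, no sign of `ν` —
and a test field `q` jointly `C²` with slices supported in a fixed compact set:

  `d/dt ∫ q G = ∫ (∂ₜq + u·∇q + (div u) q − νΔq) G`   (`hasDerivAt_integral_mul_kernel_compressible`).

With `div u = 0` the source term drops and this is the first-variation identity
`hasDerivAt_integral_mul_adaptedKernel` of the tree's
`Theorems/AdaptedFrequencyTangentFlowTransferKernelCalculus.lean` (item `TangentFlowTransfer`), whose
parametric-differentiation and Green-identity lemmas (parent namespace
`Summit.NavierStokesRegularity.NavierStokesRegularity.Theorems`) are imported and used unqualified.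
Used by `DivFreeLoadBearing.lean` (`div b = 0` is load-bearing for the linear kernel theorem `C⁺`)
and `ClauseRedundancy.lean`; reusable by the picked line's `stub_expMoment` (tested moment ODEs).

References: A. Friedman, *Partial Differential Equations of Parabolic Type* (1964), Ch. 1 §8
(8.3)–(8.5); J. Leray, Acta Math. 63 (1934), §6 (1.11); L. C. Evans, *PDE* (2010), §7.1.2 (b),
App. C.2 Thm 3.
-/

noncomputable section

open MeasureTheory Set Function Filter Topology Metric
open scoped InnerProductSpace RealInnerProductSpace Laplacian ContDiff

namespace Summit.NavierStokesRegularity.NavierStokesRegularity.Theorems.AdaptedKernelExistsNegative.DivFree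

open Literature.Analysis Literature.Analysis.FluidPDE

/-! ### Compressible integration by parts and the compressible first variation -/


section IBP

variable {E : Type*} [NormedAddCommGroup E] [InnerProductSpace ℝ E] [FiniteDimensional ℝ E]
  [MeasurableSpace E] [BorelSpace E]

/-- **Transport against a COMPRESSIBLE drift**: for `q ∈ C¹_c(E)`, `G ∈ C¹(E)` and a `C¹` vector
field `b`, `∫ q (b·∇G) = −∫ G (b·∇q) − ∫ q G div b` (apply `∫ θ div b + ∫ ⟪b, ∇θ⟫ = 0` to
`θ = q G`; Leray 1934, §6 (1.11)). The divergence-free case is the tree's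
`integral_mul_fderiv_apply_eq_neg_of_divergence_eq_zero`. [folklore] -/
theorem integral_mul_fderiv_apply_eq_of_divergence {q G : E → ℝ} {b : E → E}
    (hq : ContDiff ℝ 1 q) (hG : ContDiff ℝ 1 G) (hb : ContDiff ℝ 1 b) (hc : HasCompactSupport q) :
    ∫ x, q x * fderiv ℝ G x (b x) =
      -(∫ x, G x * fderiv ℝ q x (b x)) - ∫ x, q x * G x * VectorCalculus.divergence b x := by
  have hθ : ContDiff ℝ 1 fun x => q x * G x := hq.mul hG
  have hθc : HasCompactSupport fun x => q x * G x := hc.mono (Function.support_mul_subset_left q G)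
  have key := integral_mul_divergence_add_eq_zero_left hθ hb hθc
  -- expand `⟪b, ∇(qG)⟫ = q (DG b) + G (Dq b)`
  have hqd : ∀ x, DifferentiableAt ℝ q x := fun x => hq.differentiable one_ne_zero x
  have hGd : ∀ x, DifferentiableAt ℝ G x := fun x => hG.differentiable one_ne_zero x
  have hpt : (fun x => ⟪b x, gradient (fun y => q y * G y) x⟫) =
      fun x => q x * fderiv ℝ G x (b x) + G x * fderiv ℝ q x (b x) := by
    funext x
    rw [real_inner_comm, inner_gradient_left, fderiv_fun_mul (hqd x) (hGd x)]
    simp only [add_apply, FunLike.coe_smul, Pi.smul_apply,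
      smul_eq_mul]
  rw [hpt] at key
  have hi₁ : Integrable (fun x => q x * fderiv ℝ G x (b x)) (volume : Measure E) :=
    (hq.continuous.mul ((hG.continuous_fderiv one_ne_zero).clm_apply hb.continuous))
      |>.integrable_of_hasCompactSupport (hc.mono (Function.support_mul_subset_left _ _))
  have hi₂ : Integrable (fun x => G x * fderiv ℝ q x (b x)) (volume : Measure E) := by
    refine (hG.continuous.mul ((hq.continuous_fderiv one_ne_zero).clm_apply hb.continuous))
      |>.integrable_of_hasCompactSupport ((hc.fderiv (𝕜 := ℝ)).mono fun x hx => ?_)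
    contrapose! hx
    simp only [Function.mem_support, ne_eq, not_not] at hx ⊢
    simp [hx]
  rw [integral_add hi₁ hi₂] at key
  linarith

/-- **Compressible first variation against a backward kernel.** Let `S` be an open set of times,
`G` jointly `C²` on `S × E` solving `∂ₜG + u·∇G + νΔG = 0` there, the drift slices `u(t,·) ∈ C¹`
(NO divergence condition). Then for every test field `q` jointly `C²` on `S × E` with slices
supported in a fixed compact `K`, and every `t ∈ S`,
`d/dt ∫ q G = ∫ (∂ₜq + u·∇q + (div u) q − νΔq) G`.
With `div u = 0` this is the tree's `hasDerivAt_integral_mul_adaptedKernel` (the extra term is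
the compressibility source `∫ (div u) q G`). [cite: Friedman1964, Ch. 1 §8 (8.3)–(8.5)] -/
theorem hasDerivAt_integral_mul_kernel_compressible {ν : ℝ} {u : ℝ → E → E} {S : Set ℝ}
    {G q : ℝ → E → ℝ} (hS : IsOpen S) (hG : ContDiffOn ℝ 2 (uncurry G) (S ×ˢ univ))
    (hadj : ∀ t ∈ S, ∀ x,
      timeDerivWithin S G t x + fderiv ℝ (G t) x (u t x) + ν * (Δ (G t)) x = 0)
    (hu : ∀ t ∈ S, ContDiff ℝ 1 (u t))
    (hq : ContDiffOn ℝ 2 (uncurry q) (S ×ˢ univ)) {K : Set E} (hK : IsCompact K)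
    (hsupp : ∀ t ∈ S, ∀ x ∉ K, q t x = 0) {t : ℝ} (ht : t ∈ S) :
    HasDerivAt (fun s => ∫ x, q s x * G s x)
      (∫ x, (deriv (fun s => q s x) t + fderiv ℝ (q t) x (u t x) +
        VectorCalculus.divergence (u t) x * q t x - ν * (Δ (q t)) x) * G t x) t := by
  have h12 : (1 : WithTop ℕ∞) ≤ 2 := by norm_num
  set Φ : ℝ → E → ℝ := fun s x => q s x * G s x with hΦ
  have hΦ1 : ContDiffOn ℝ 2 (uncurry Φ) (S ×ˢ univ) := by
    have := hq.mul hG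
    exact this.congr fun z _ => by obtain ⟨s, x⟩ := z; rfl
  have hΦsupp : ∀ s ∈ S, ∀ x ∉ K, Φ s x = 0 := fun s hs x hx => by
    simp only [hΦ, hsupp s hs x hx, zero_mul]
  have key := hasDerivAt_integral_of_contDiffOn_of_support_subset (μ := (volume : Measure E))
    hS hΦ1 h12 hK hΦsupp ht
  have hqt : ContDiff ℝ 2 (q t) := contDiff_slice_of_contDiffOn_prod_univ hq ht
  have hGt : ContDiff ℝ 2 (G t) := contDiff_slice_of_contDiffOn_prod_univ hG ht
  have hqt1 : ContDiff ℝ 1 (q t) := hqt.of_le one_le_two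
  have hGt1 : ContDiff ℝ 1 (G t) := hGt.of_le one_le_two
  have hut := hu t ht
  have hqc : HasCompactSupport (q t) := HasCompactSupport.intro hK (hsupp t ht)
  set q' : E → ℝ := fun x => deriv (fun s => q s x) t with hq'
  set G' : E → ℝ := fun x => deriv (fun s => G s x) t with hG'
  have hqd : ∀ x, HasDerivAt (fun s => q s x) (q' x) t := fun x =>
    (hasDerivAt_timeLine_of_contDiffOn hS hq h12 ht x).differentiableAt.hasDerivAt
  have hGd : ∀ x, HasDerivAt (fun s => G s x) (G' x) t := fun x =>
    (hasDerivAt_timeLine_of_contDiffOn hS hG h12 ht x).differentiableAt.hasDerivAt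
  have hG'eq : ∀ x, G' x = -(fderiv ℝ (G t) x (u t x)) - ν * (Δ (G t)) x := fun x => by
    have h := hadj t ht x
    rw [timeDerivWithin_eq_deriv hS ht] at h
    rw [hG']; dsimp only
    linarith
  have hderiv : ∀ x, deriv (fun s => Φ s x) t =
      q' x * G t x + q t x * (-(fderiv ℝ (G t) x (u t x)) - ν * (Δ (G t)) x) := fun x => by
    rw [show (fun s => Φ s x) = (fun s => q s x) * fun s => G s x from rfl,
      ((hqd x).mul (hGd x)).deriv, hG'eq x]
  have hq'c : Continuous q' :=
    continuous_slice_of_continuousOn_prod_univ (continuousOn_deriv_timeLine_of_contDiffOn hS hq h12) ht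
  have hq's : ∀ x ∉ K, q' x = 0 := fun x hx => by
    have : (fun r => q r x) =ᶠ[𝓝 t] fun _ => (0 : ℝ) := by
      filter_upwards [hS.mem_nhds ht] with r hr using hsupp r hr x hx
    show deriv (fun r => q r x) t = 0
    rw [this.deriv_eq, deriv_const]
  have hq'cs : HasCompactSupport q' := HasCompactSupport.intro hK hq's
  have hDq0 : ∀ x ∉ K, fderiv ℝ (q t) x = 0 := fun x hx =>
    fderiv_eq_zero_of_eq_zero_off hK (hsupp t ht) hx
  have hΔq0 : ∀ x ∉ K, (Δ (q t)) x = 0 := fun x hx =>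
    laplacian_eq_zero_of_eq_zero_off hK (hsupp t ht) hx
  have hGc : Continuous (G t) := hGt.continuous
  have hDGu : Continuous fun x => fderiv ℝ (G t) x (u t x) :=
    (hGt1.continuous_fderiv one_ne_zero).clm_apply hut.continuous
  have hDqu : Continuous fun x => fderiv ℝ (q t) x (u t x) :=
    (hqt1.continuous_fderiv one_ne_zero).clm_apply hut.continuous
  have hΔG : Continuous (Δ (G t)) := continuous_laplacian hGt
  have hΔq : Continuous (Δ (q t)) := continuous_laplacian hqt
  have hdivc : Continuous fun x => VectorCalculus.divergence (u t) x :=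
    continuous_divergence (hut.continuous_fderiv one_ne_zero)
  have i₁ : Integrable (fun x => q' x * G t x) (volume : Measure E) :=
    (hq'c.mul hGc).integrable_of_hasCompactSupport (hq'cs.mono (Function.support_mul_subset_left _ _))
  have i₂ : Integrable (fun x => q t x * fderiv ℝ (G t) x (u t x)) (volume : Measure E) :=
    (hqt.continuous.mul hDGu).integrable_of_hasCompactSupport
      (hqc.mono (Function.support_mul_subset_left _ _))
  have i₃ : Integrable (fun x => q t x * (Δ (G t)) x) (volume : Measure E) :=
    (hqt.continuous.mul hΔG).integrable_of_hasCompactSupport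
      (hqc.mono (Function.support_mul_subset_left _ _))
  have i₄ : Integrable (fun x => fderiv ℝ (q t) x (u t x) * G t x) (volume : Measure E) := by
    refine (hDqu.mul hGc).integrable_of_hasCompactSupport (HasCompactSupport.intro hK fun x hx => ?_)
    simp [hDq0 x hx]
  have i₅ : Integrable (fun x => (Δ (q t)) x * G t x) (volume : Measure E) := by
    refine (hΔq.mul hGc).integrable_of_hasCompactSupport (HasCompactSupport.intro hK fun x hx => ?_)
    simp [hΔq0 x hx]
  have i₆ : Integrable (fun x => q t x * G t x * VectorCalculus.divergence (u t) x)
      (volume : Measure E) :=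
    ((hqt.continuous.mul hGc).mul hdivc).integrable_of_hasCompactSupport
      ((hqc.mono (Function.support_mul_subset_left _ _)).mono (Function.support_mul_subset_left _ _))
  -- the two integrations by parts
  have ibp₁ : ∫ x, q t x * fderiv ℝ (G t) x (u t x) =
      -(∫ x, G t x * fderiv ℝ (q t) x (u t x)) -
        ∫ x, q t x * G t x * VectorCalculus.divergence (u t) x :=
    integral_mul_fderiv_apply_eq_of_divergence hqt1 hGt1 hut hqc
  have ibp₂ : ∫ x, q t x * (Δ (G t)) x = ∫ x, (Δ (q t)) x * G t x :=
    integral_mul_laplacian_eq_integral_laplacian_mul hqt hGt hqc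
  -- assemble
  have hL : ∫ x, deriv (fun s => Φ s x) t =
      (∫ x, q' x * G t x) - (∫ x, q t x * fderiv ℝ (G t) x (u t x)) -
        ν * ∫ x, q t x * (Δ (G t)) x := by
    have e : (fun x => deriv (fun s => Φ s x) t) =
        fun x => q' x * G t x - q t x * fderiv ℝ (G t) x (u t x) - ν * (q t x * (Δ (G t)) x) := by
      funext x; rw [hderiv x]; ring
    have i₁₂ : Integrable (fun x => q' x * G t x - q t x * fderiv ℝ (G t) x (u t x))
        (volume : Measure E) := i₁.sub i₂
    have i₃' : Integrable (fun x => ν * (q t x * (Δ (G t)) x)) (volume : Measure E) := i₃.const_mul ν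
    rw [e, integral_sub i₁₂ i₃', integral_sub i₁ i₂, integral_const_mul]
  have hR : ∫ x, (q' x + fderiv ℝ (q t) x (u t x) +
        VectorCalculus.divergence (u t) x * q t x - ν * (Δ (q t)) x) * G t x =
      (∫ x, q' x * G t x) + (∫ x, fderiv ℝ (q t) x (u t x) * G t x) +
        (∫ x, q t x * G t x * VectorCalculus.divergence (u t) x) -
        ν * ∫ x, (Δ (q t)) x * G t x := by
    have e : (fun x => (q' x + fderiv ℝ (q t) x (u t x) +
        VectorCalculus.divergence (u t) x * q t x - ν * (Δ (q t)) x) * G t x) =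
        fun x => q' x * G t x + fderiv ℝ (q t) x (u t x) * G t x +
          q t x * G t x * VectorCalculus.divergence (u t) x - ν * ((Δ (q t)) x * G t x) := by
      funext x; ring
    have i₁₄ : Integrable (fun x => q' x * G t x + fderiv ℝ (q t) x (u t x) * G t x)
        (volume : Measure E) := i₁.add i₄
    have i₁₄₆ : Integrable (fun x => q' x * G t x + fderiv ℝ (q t) x (u t x) * G t x +
        q t x * G t x * VectorCalculus.divergence (u t) x) (volume : Measure E) := i₁₄.add i₆
    have i₅' : Integrable (fun x => ν * ((Δ (q t)) x * G t x)) (volume : Measure E) := i₅.const_mul ν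
    rw [e, integral_sub i₁₄₆ i₅', integral_add i₁₄ i₆, integral_add i₁ i₄, integral_const_mul]
  have hmid : (∫ x, fderiv ℝ (q t) x (u t x) * G t x) = ∫ x, G t x * fderiv ℝ (q t) x (u t x) :=
    integral_congr_ae (Eventually.of_forall fun x => mul_comm _ _)
  have heq : ∫ x, deriv (fun s => Φ s x) t =
      ∫ x, (q' x + fderiv ℝ (q t) x (u t x) +
        VectorCalculus.divergence (u t) x * q t x - ν * (Δ (q t)) x) * G t x := by
    rw [hL, hR, ibp₁, ibp₂, hmid]; ring
  rw [← heq]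
  exact key

end IBP

end Summit.NavierStokesRegularity.NavierStokesRegularity.Theorems.AdaptedKernelExistsNegative.DivFree

end
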